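import Summits.AtomisticToContinuum.Crystallization.Theorems.FrustratedLawDichotomyStrainedPatchHomLeafPointsParam

/-!
# Leaf soundness, VECTOR FORM (hcp P-twin) — the def-free semantic layer

decomp-a2c hand-2 g25 (crux `AperiodicFrustratedLawGap`, stmt-AtomisticToContinuum-27623; (H) hcp side, critic rows 887/891/893).  The semantic
layer behind the scaled-frame vector-form leaf `…HomLeafTableCheckHcpV.leafCheckV`:

* §1 ★ `abs_dev_le` — the per-label DEVIATION bound: for a matrix `V` in the box `|V − V̂| ≤ Ŵ`, a scaled shuffle `η` in `|η − η̂| ≤ Ŵη`, a centre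
  vector `z` and a family bit `u ∈ {0,1}`, the row-`a` deviation `d_a = Σ_c V_ac (z_c + u(η_c − η̂_c)) − Σ_c V̂_ac z_c` satisfies
  `|d_a| ≤ D_a := Σ_c Ŵ_ac |z_c| + u (Σ_c |V̂_ac| Ŵη_c + Σ_c Ŵ_ac Ŵη_c)`;
* §2 ★ `abs_normSq_sub_le` — the per-label VALUE bound `|‖V z‖² − ‖V̂ z⁰‖²| ≤ 2 Σ_a |P_a| D_a + Σ_a D_a²` (`P = V̂ z⁰`), from
  `q − q̂ = Σ_a (2 P_a d_a + d_a²)`;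
* §3 ★★ `leaf_sound_vector_form` — the ASSEMBLY with an inexact (floored) centre value: per treated label a reference value `Qc` with
  `Qc ≤ q̂ ≤ Qc + ε`, a radius `R1 ≥ |q − q̂|`, a certified row (value `V ≤ φ(p)`, `|φ'(p) − D̂| ≤ E`, `|D̂| ≤ aD`, curvature `M`, range
  `[lo, hi] ⊇ [Qc − R1, Qc + R1 + ε]`, `p ≤ Qc`), and the FIRST+SECOND-ORDER FUNCTIONAL bound `−PEN ≤ Σ D̂_v (q_v − q̂_v)` as a hypothesis; then
  `m ≤ Σ V + Σ D̂ δ − E Σ δ − ε Σ (aD + E) − E Σ R1 − PEN − ½ Σ M (δ + R1 + ε)²` (`δ = Qc − p`) implies `m ≤ Σ φ(q_v)`.  With `R1 = (R−1)/SC`,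
  `ε = 1/SC` this is the kernel's `lhsV ≤ rhsV` read in reals (companion bridge module).

No definitions; 0 sorry; standard axioms.  `--supports stmt-AtomisticToContinuum-27623`.
-/

noncomputable section

namespace Summit.AtomisticToContinuum.Crystallization.Theorems.FrustratedLawDichotomyStrainedPatchHomLeafVectorForm

open scoped BigOperators
open Set Finset
open Summit.AtomisticToContinuum.Crystallization.Theorems.FrustratedLawDichotomyStrainedPatchHomCentredForm (tangent_parabola_le)
open Summit.AtomisticToContinuum.Crystallization.Theorems.FrustratedLawDichotomyStrainedPatchHomLeafPointsParam (abs_linear_le)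

/-! ## §1. The per-label deviation bound -/

/-- ★ **DEVIATION BOUND.**  `|Σ_c V_ac (z_c + u(η_c − η̂_c)) − Σ_c V̂_ac z_c| ≤ Σ_c Ŵ_ac |z_c| + u (Σ_c |V̂_ac| Ŵη_c + Σ_c Ŵ_ac Ŵη_c)` for `u ∈ {0, 1}`,
`|V_ac − V̂_ac| ≤ Ŵ_ac`, `|η_c − η̂_c| ≤ Ŵη_c`. [folklore: interval bookkeeping] -/
theorem abs_dev_le (V V₀ W : Fin 3 → ℝ) (η η₀ Wη z : Fin 3 → ℝ) (u : ℝ) (hu : u = 0 ∨ u = 1)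
    (hV : ∀ c, |V c - V₀ c| ≤ W c) (hη : ∀ c, |η c - η₀ c| ≤ Wη c) :
    |∑ c, V c * (z c + u * (η c - η₀ c)) - ∑ c, V₀ c * z c| ≤
      ∑ c, W c * |z c| + u * (∑ c, |V₀ c| * Wη c + ∑ c, W c * Wη c) := by
  have hW : ∀ c, 0 ≤ W c := fun c => (abs_nonneg _).trans (hV c)
  have hWη : ∀ c, 0 ≤ Wη c := fun c => (abs_nonneg _).trans (hη c)
  -- split: d = Σ (V − V₀) z + u Σ V₀ (η − η₀) + u Σ (V − V₀)(η − η₀)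
  have hsplit : ∑ c, V c * (z c + u * (η c - η₀ c)) - ∑ c, V₀ c * z c =
      ∑ c, (V c - V₀ c) * z c + u * (∑ c, V₀ c * (η c - η₀ c) + ∑ c, (V c - V₀ c) * (η c - η₀ c)) := by
    simp only [Finset.mul_sum, ← Finset.sum_add_distrib, ← Finset.sum_sub_distrib]
    exact Finset.sum_congr rfl fun c _ => by ring
  rw [hsplit]
  have h1 : |∑ c, (V c - V₀ c) * z c| ≤ ∑ c, W c * |z c| := by
    refine (abs_sum_le_sum_abs _ _).trans (Finset.sum_le_sum fun c _ => ?_)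
    rw [abs_mul]; exact mul_le_mul_of_nonneg_right (hV c) (abs_nonneg _)
  have h2 : |∑ c, V₀ c * (η c - η₀ c)| ≤ ∑ c, |V₀ c| * Wη c := by
    refine (abs_sum_le_sum_abs _ _).trans (Finset.sum_le_sum fun c _ => ?_)
    rw [abs_mul]; exact mul_le_mul_of_nonneg_left (hη c) (abs_nonneg _)
  have h3 : |∑ c, (V c - V₀ c) * (η c - η₀ c)| ≤ ∑ c, W c * Wη c := by
    refine (abs_sum_le_sum_abs _ _).trans (Finset.sum_le_sum fun c _ => ?_)
    rw [abs_mul]; exact mul_le_mul (hV c) (hη c) (abs_nonneg _) (hW c)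
  have h23 : |∑ c, V₀ c * (η c - η₀ c) + ∑ c, (V c - V₀ c) * (η c - η₀ c)| ≤ ∑ c, |V₀ c| * Wη c + ∑ c, W c * Wη c :=
    (abs_add_le _ _).trans (add_le_add h2 h3)
  rcases hu with rfl | rfl
  · simp only [zero_mul, add_zero]; exact h1
  · simp only [one_mul]; exact (abs_add_le _ _).trans (add_le_add h1 h23)

/-! ## §2. The per-label value bound -/

/-- `q − q̂ = Σ_a (2 P_a d_a + d_a²)` when `x_a = P_a + d_a`. [formal bookkeeping] -/
theorem sumSq_sub_sumSq (x P : Fin 3 → ℝ) : ∑ a, x a ^ 2 - ∑ a, P a ^ 2 = ∑ a, (2 * P a * (x a - P a) + (x a - P a) ^ 2) := by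
  rw [← Finset.sum_sub_distrib]; exact Finset.sum_congr rfl fun a _ => by ring

/-- ★ **VALUE BOUND.**  If `|x_a − P_a| ≤ D_a` for every row then `|Σ_a x_a² − Σ_a P_a²| ≤ 2 Σ_a |P_a| D_a + Σ_a D_a²`. [folklore] -/
theorem abs_sumSq_sub_le (x P D : Fin 3 → ℝ) (hd : ∀ a, |x a - P a| ≤ D a) :
    |∑ a, x a ^ 2 - ∑ a, P a ^ 2| ≤ 2 * ∑ a, |P a| * D a + ∑ a, D a ^ 2 := by
  rw [sumSq_sub_sumSq, Finset.mul_sum, ← Finset.sum_add_distrib]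
  refine (abs_sum_le_sum_abs _ _).trans (Finset.sum_le_sum fun a _ => ?_)
  have hD : 0 ≤ D a := (abs_nonneg _).trans (hd a)
  have h1 : |2 * P a * (x a - P a)| ≤ 2 * (|P a| * D a) := by
    rw [abs_mul, abs_mul, abs_two, mul_assoc]
    exact mul_le_mul_of_nonneg_left (mul_le_mul_of_nonneg_left (hd a) (abs_nonneg _)) zero_le_two
  have h2 : |(x a - P a) ^ 2| ≤ D a ^ 2 := by
    rw [abs_pow]; exact pow_le_pow_left₀ (abs_nonneg _) (hd a) 2
  exact (abs_add_le _ _).trans (add_le_add h1 h2)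

/-- ★ The value bound for the scaled-frame point: with `x_a = Σ_c V_ac (z_c + u(η_c − η̂_c))`, `P_a = Σ_c V̂_ac z_c` and the deviation bounds `D_a` of
`abs_dev_le`, `|Σ_a x_a² − Σ_a P_a²| ≤ 2 Σ_a |P_a| D_a + Σ_a D_a²`. [folklore] -/
theorem abs_normSq_sub_le (V V₀ W : Fin 3 → Fin 3 → ℝ) (η η₀ Wη z : Fin 3 → ℝ) (u : ℝ) (hu : u = 0 ∨ u = 1)
    (hV : ∀ a c, |V a c - V₀ a c| ≤ W a c) (hη : ∀ c, |η c - η₀ c| ≤ Wη c) :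
    |∑ a, (∑ c, V a c * (z c + u * (η c - η₀ c))) ^ 2 - ∑ a, (∑ c, V₀ a c * z c) ^ 2| ≤
      2 * ∑ a, |∑ c, V₀ a c * z c| * (∑ c, W a c * |z c| + u * (∑ c, |V₀ a c| * Wη c + ∑ c, W a c * Wη c)) +
        ∑ a, (∑ c, W a c * |z c| + u * (∑ c, |V₀ a c| * Wη c + ∑ c, W a c * Wη c)) ^ 2 :=
  abs_sumSq_sub_le _ _ _ fun a => abs_dev_le (V a) (V₀ a) (W a) η η₀ Wη z u hu (hV a) hη

/-! ## §3. ★★ The assembly with a floored centre value -/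

/-- ★★ **LEAF SOUNDNESS, VECTOR FORM (assembly).**  See the module docstring.  `q v` are the actual values, `qh v` the exact centre values, `Qc v` the
(floored) reference values used by the checker, `R1 v` the radii, `p v` the rows' expansion points. [folklore: tangent parabola + interval bookkeeping] -/
theorem leaf_sound_vector_form {ι : Type*} (S : Finset ι) (φ φ' : ι → ℝ → ℝ) (q qh Qc R1 p Vv Dh aD M lo hi : ι → ℝ) (E ε PEN m : ℝ)
    (hE : 0 ≤ E) (hε : 0 ≤ ε) (hM : ∀ v ∈ S, 0 ≤ M v)
    (hd : ∀ v ∈ S, ∀ t ∈ Icc (lo v) (hi v), HasDerivAt (φ v) (φ' v t) t)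
    (hmono : ∀ v ∈ S, MonotoneOn (fun t => φ' v t + M v * t) (Icc (lo v) (hi v)))
    (hp : ∀ v ∈ S, p v ∈ Icc (lo v) (hi v))
    (hq : ∀ v ∈ S, |q v - qh v| ≤ R1 v) (hQ : ∀ v ∈ S, Qc v ≤ qh v ∧ qh v ≤ Qc v + ε)
    (hlo : ∀ v ∈ S, lo v ≤ Qc v - R1 v) (hhi : ∀ v ∈ S, Qc v + R1 v + ε ≤ hi v) (hpQ : ∀ v ∈ S, p v ≤ Qc v)
    (hV : ∀ v ∈ S, Vv v ≤ φ v (p v)) (hD : ∀ v ∈ S, |φ' v (p v) - Dh v| ≤ E) (haD : ∀ v ∈ S, |Dh v| ≤ aD v)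
    (hF : -PEN ≤ ∑ v ∈ S, Dh v * (q v - qh v))
    (hcheck : m ≤ ∑ v ∈ S, Vv v + ∑ v ∈ S, Dh v * (Qc v - p v) - E * ∑ v ∈ S, (Qc v - p v) - ε * ∑ v ∈ S, (aD v + E)
        - E * ∑ v ∈ S, R1 v - PEN - 1 / 2 * ∑ v ∈ S, M v * (Qc v - p v + R1 v + ε) ^ 2) :
    m ≤ ∑ v ∈ S, φ v (q v) := by
  -- ranges
  have hR1 : ∀ v ∈ S, 0 ≤ R1 v := fun v hv => (abs_nonneg _).trans (hq v hv)
  have hrange : ∀ v ∈ S, q v ∈ Icc (lo v) (hi v) := by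
    intro v hv
    have h1 := abs_le.1 (hq v hv); have h2 := hQ v hv; have h3 := hlo v hv; have h4 := hhi v hv
    exact ⟨by linarith [h1.1], by linarith [h1.2]⟩
  -- tangent parabolas, summed
  have htan : ∑ v ∈ S, (φ v (p v) + φ' v (p v) * (q v - p v) - M v / 2 * (q v - p v) ^ 2) ≤ ∑ v ∈ S, φ v (q v) :=
    Finset.sum_le_sum fun v hv => tangent_parabola_le (hp v hv) (hrange v hv) (hd v hv) (hmono v hv)
  -- values
  have hval : ∑ v ∈ S, Vv v ≤ ∑ v ∈ S, φ v (p v) := Finset.sum_le_sum hV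
  -- linear part, per label: φ'(p)(q − p) = φ'(p)δ + φ'(p)(qh − Qc) + Dh (q − qh) + (φ'(p) − Dh)(q − qh)
  have hlin : ∀ v ∈ S, Dh v * (Qc v - p v) - E * (Qc v - p v) - ε * (aD v + E) - E * R1 v + Dh v * (q v - qh v) ≤
      φ' v (p v) * (q v - p v) := by
    intro v hv
    have hDv := abs_le.1 (hD v hv); have haDv := abs_le.1 (haD v hv); have hQv := hQ v hv; have hqv := abs_le.1 (hq v hv)
    have hδ : 0 ≤ Qc v - p v := by linarith [hpQ v hv]
    have e : φ' v (p v) * (q v - p v) = φ' v (p v) * (Qc v - p v) + φ' v (p v) * (qh v - Qc v) + Dh v * (q v - qh v) +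
        (φ' v (p v) - Dh v) * (q v - qh v) := by ring
    rw [e]
    -- (i) φ'(p) δ ≥ (Dh − E) δ
    have i1 : (Dh v - E) * (Qc v - p v) ≤ φ' v (p v) * (Qc v - p v) := mul_le_mul_of_nonneg_right (by linarith [hDv.1]) hδ
    -- (ii) φ'(p)(qh − Qc) ≥ −(aD + E) ε
    have i2 : -((aD v + E) * ε) ≤ φ' v (p v) * (qh v - Qc v) := by
      have hs0 : 0 ≤ qh v - Qc v := by linarith [hQv.1]
      have hs1 : qh v - Qc v ≤ ε := by linarith [hQv.2]
      have hφlo : -(aD v + E) ≤ φ' v (p v) := by linarith [hDv.1, haDv.1]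
      have haE : 0 ≤ aD v + E := by linarith [haDv.1, haDv.2]
      calc -((aD v + E) * ε) ≤ -((aD v + E) * (qh v - Qc v)) := by nlinarith
        _ = -(aD v + E) * (qh v - Qc v) := by ring
        _ ≤ φ' v (p v) * (qh v - Qc v) := mul_le_mul_of_nonneg_right hφlo hs0
    -- (iii) (φ'(p) − Dh)(q − qh) ≥ −E R1
    have i3 : -(E * R1 v) ≤ (φ' v (p v) - Dh v) * (q v - qh v) := by
      have := abs_mul (φ' v (p v) - Dh v) (q v - qh v)
      have hb : |(φ' v (p v) - Dh v) * (q v - qh v)| ≤ E * R1 v := by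
        rw [this]; exact mul_le_mul (hD v hv) (hq v hv) (abs_nonneg _) hE
      linarith [(abs_le.1 hb).1]
    nlinarith [i1, i2, i3]
  have hlinS : ∑ v ∈ S, (Dh v * (Qc v - p v) - E * (Qc v - p v) - ε * (aD v + E) - E * R1 v + Dh v * (q v - qh v)) ≤
      ∑ v ∈ S, φ' v (p v) * (q v - p v) := Finset.sum_le_sum hlin
  have hlinS' : ∑ v ∈ S, (Dh v * (Qc v - p v) - E * (Qc v - p v) - ε * (aD v + E) - E * R1 v + Dh v * (q v - qh v)) =
      ∑ v ∈ S, Dh v * (Qc v - p v) - E * ∑ v ∈ S, (Qc v - p v) - ε * ∑ v ∈ S, (aD v + E) - E * ∑ v ∈ S, R1 v +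
        ∑ v ∈ S, Dh v * (q v - qh v) := by
    rw [Finset.sum_add_distrib, Finset.sum_sub_distrib, Finset.sum_sub_distrib, Finset.sum_sub_distrib, ← Finset.mul_sum, ← Finset.mul_sum,
      ← Finset.mul_sum]
  -- quadratic part
  have hquad : ∑ v ∈ S, M v / 2 * (q v - p v) ^ 2 ≤ 1 / 2 * ∑ v ∈ S, M v * (Qc v - p v + R1 v + ε) ^ 2 := by
    rw [Finset.mul_sum]
    refine Finset.sum_le_sum fun v hv => ?_
    have hqv := abs_le.1 (hq v hv); have hQv := hQ v hv
    have hδ : 0 ≤ Qc v - p v := by linarith [hpQ v hv]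
    have h2 : |q v - p v| ≤ Qc v - p v + R1 v + ε := by
      rw [abs_le]; constructor <;> linarith [hR1 v hv]
    have hsq : (q v - p v) ^ 2 ≤ (Qc v - p v + R1 v + ε) ^ 2 := by
      calc (q v - p v) ^ 2 = |q v - p v| ^ 2 := (sq_abs _).symm
        _ ≤ _ := pow_le_pow_left₀ (abs_nonneg _) h2 2
    have := mul_le_mul_of_nonneg_left hsq (hM v hv)
    linarith
  -- assemble
  have hsum : ∑ v ∈ S, (φ v (p v) + φ' v (p v) * (q v - p v) - M v / 2 * (q v - p v) ^ 2)
      = ∑ v ∈ S, φ v (p v) + ∑ v ∈ S, φ' v (p v) * (q v - p v) - ∑ v ∈ S, M v / 2 * (q v - p v) ^ 2 := by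
    rw [← Finset.sum_add_distrib, ← Finset.sum_sub_distrib]
  linarith [htan, hsum, hval, hlinS, hlinS', hquad, hF, hcheck]

/-- The FAR case in the vector form: if `|q − q̂| ≤ R1`, `Qc ≤ q̂` and `81/4 ≤ Qc − R1` then the term is beyond the cutoff, `81/4 ≤ q`.
[formal bookkeeping] -/
theorem far_of_ref {q qh Qc R1 : ℝ} (hq : |q - qh| ≤ R1) (hQ : Qc ≤ qh) (hfar : (81 : ℝ) / 4 ≤ Qc - R1) : (81 : ℝ) / 4 ≤ q := by
  have h := (abs_le.1 hq).1
  linarith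

end Summit.AtomisticToContinuum.Crystallization.Theorems.FrustratedLawDichotomyStrainedPatchHomLeafVectorForm

end
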